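import Summits.Ventures.DiscreteObjects.Hadamard.ParityCyclotomic29

/-!
# Irreducible factors of cyclotomic polynomials: which `X^L ∓ 1` they divide (kernel)

Framing: lottery ticket; floor = certified bounds/negative ranges.

Cell pub-namedobj (venture DiscreteObjects), target (H), hadamard gen 15.  Field-theoretic input of the cycle reading of the
even-multiplicity theorem (`HadamardSignedAutParity`): for an irreducible factor `h` of the cyclotomic polynomial `Φ_m` over
a field `F` with `m ≠ 0` in `F`, the root `α` of `h` in `F[X]/(h)` is a primitive `m`-th root of unity
(`isPrimitiveRoot_root_of_dvd_cyclotomic`), so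
* `cyclotomic_factor_dvd_X_pow_sub_one_iff` — `h ∣ X^L - 1 ↔ m ∣ L`;
* `cyclotomic_factor_dvd_X_pow_add_one_iff` — `h ∣ X^L + 1 ↔ m ∣ 2L ∧ m ∤ L` (characteristic `≠ 2`);
and in the negative cases `h` is COPRIME to `X^L ∓ 1` (`Irreducible.coprime_iff_not_dvd`).  In the cycle reading, a signed
cycle of length `L` and sign `ε` (characteristic block `X^L - ε`) carries the factor `h` exactly in these cases.
Elementary; ours; no `sorry`.
-/

open Polynomial

namespace Summit.Ventures.DiscreteObjects.Hadamard

variable {F : Type*} [Field F]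

/-- divisibility by `h` is vanishing at the root of `h` in `F[X]/(h)` -/
theorem dvd_iff_aeval_root_eq_zero (h g : F[X]) : h ∣ g ↔ aeval (AdjoinRoot.root h) g = 0 := by
  rw [AdjoinRoot.aeval_eq, AdjoinRoot.mk_eq_zero]

/-- `h ∣ X^L - C ε ↔ α^L = ε` for the root `α` of `h` -/
theorem dvd_X_pow_sub_C_iff_root (h : F[X]) (L : ℕ) (ε : F) :
    h ∣ X ^ L - C ε ↔ AdjoinRoot.root h ^ L = AdjoinRoot.of h ε := by
  rw [dvd_iff_aeval_root_eq_zero, map_sub, map_pow, aeval_X, aeval_C, sub_eq_zero, AdjoinRoot.algebraMap_eq]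

/-- the root of an irreducible factor of `Φ_m` (`m ≠ 0` in `F`) is a primitive `m`-th root of unity -/
theorem isPrimitiveRoot_root_of_dvd_cyclotomic {m : ℕ} (hm : (m : F) ≠ 0) {h : F[X]} (hirr : Irreducible h)
    (hdvd : h ∣ cyclotomic m F) : IsPrimitiveRoot (AdjoinRoot.root h) m := by
  haveI : Fact (Irreducible h) := ⟨hirr⟩
  haveI : NeZero (m : AdjoinRoot h) := ⟨by
    intro h0
    apply hm
    apply (algebraMap F (AdjoinRoot h)).injective
    rw [map_natCast, h0, map_zero]⟩
  rw [← isRoot_cyclotomic_iff, IsRoot.def, ← map_cyclotomic m (algebraMap F (AdjoinRoot h)), eval_map,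
    ← aeval_def]
  exact (dvd_iff_aeval_root_eq_zero h _).mp hdvd

/-- for a primitive `m`-th root `α` in characteristic `≠ 2`: `α^L = -1 ↔ m ∣ 2L ∧ m ∤ L` -/
theorem pow_eq_neg_one_iff_of_isPrimitiveRoot {K : Type*} [CommRing K] [IsDomain K] {α : K} {m : ℕ}
    (hα : IsPrimitiveRoot α m) (h2 : (2 : K) ≠ 0) (L : ℕ) : α ^ L = -1 ↔ m ∣ 2 * L ∧ ¬ m ∣ L := by
  have hne : (1 : K) ≠ -1 := fun e => h2 (by linear_combination e)
  constructor
  · intro hL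
    refine ⟨?_, fun hd => ?_⟩
    · rw [← hα.pow_eq_one_iff_dvd, pow_mul', hL]
      norm_num
    · rw [← hα.pow_eq_one_iff_dvd] at hd
      rw [hd] at hL
      exact hne hL
  · rintro ⟨h2L, hL⟩
    have hsq : α ^ L * α ^ L = 1 := by
      rw [← pow_two, ← pow_mul, mul_comm, hα.pow_eq_one_iff_dvd]
      exact h2L
    rcases mul_self_eq_one_iff.mp hsq with h1 | h1
    · exact absurd ((hα.pow_eq_one_iff_dvd L).mp h1) hL
    · exact h1

/-- **`h ∣ X^L - 1 ↔ m ∣ L`** for an irreducible factor `h` of `Φ_m` -/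
theorem cyclotomic_factor_dvd_X_pow_sub_one_iff {m : ℕ} (hm : (m : F) ≠ 0) {h : F[X]} (hirr : Irreducible h)
    (hdvd : h ∣ cyclotomic m F) (L : ℕ) : h ∣ X ^ L - 1 ↔ m ∣ L := by
  rw [← C_1, dvd_X_pow_sub_C_iff_root, map_one, (isPrimitiveRoot_root_of_dvd_cyclotomic hm hirr hdvd).pow_eq_one_iff_dvd]

/-- **`h ∣ X^L + 1 ↔ m ∣ 2L ∧ m ∤ L`** for an irreducible factor `h` of `Φ_m`, characteristic `≠ 2` -/
theorem cyclotomic_factor_dvd_X_pow_add_one_iff {m : ℕ} (hm : (m : F) ≠ 0) (h2 : (2 : F) ≠ 0) {h : F[X]}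
    (hirr : Irreducible h) (hdvd : h ∣ cyclotomic m F) (L : ℕ) : h ∣ X ^ L + 1 ↔ m ∣ 2 * L ∧ ¬ m ∣ L := by
  haveI : Fact (Irreducible h) := ⟨hirr⟩
  have e : (X ^ L + 1 : F[X]) = X ^ L - C (-1) := by rw [map_neg, C_1, sub_neg_eq_add]
  have h2' : (2 : AdjoinRoot h) ≠ 0 := by
    intro h0
    apply h2
    apply (algebraMap F (AdjoinRoot h)).injective
    rw [map_ofNat, h0, map_zero]
  rw [e, dvd_X_pow_sub_C_iff_root, map_neg, map_one,
    pow_eq_neg_one_iff_of_isPrimitiveRoot (isPrimitiveRoot_root_of_dvd_cyclotomic hm hirr hdvd) h2' L]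

/-- the plain cycle block: `X^L - C 1 = X^L - 1` -/
lemma X_pow_sub_C_one (L : ℕ) : (X ^ L - C 1 : F[X]) = X ^ L - 1 := by rw [C_1]

/-- the nega cycle block: `X^L - C (-1) = X^L + 1` -/
lemma X_pow_sub_C_neg_one (L : ℕ) : (X ^ L - C (-1) : F[X]) = X ^ L + 1 := by rw [map_neg, C_1, sub_neg_eq_add]

/-- for `m ≥ 1` an irreducible factor of `Φ_m` exists; it divides `X^m - 1` and has positive degree -/
theorem exists_irreducible_factor_cyclotomic {m : ℕ} (hm : 0 < m) :
    ∃ h : F[X], Irreducible h ∧ h ∣ cyclotomic m F ∧ h ∣ X ^ m - 1 ∧ 0 < h.natDegree := by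
  have hdeg : (cyclotomic m F).natDegree ≠ 0 := by
    rw [natDegree_cyclotomic]
    exact (Nat.totient_pos.mpr hm).ne'
  refine ⟨(cyclotomic m F).factor, irreducible_factor _, factor_dvd_of_natDegree_ne_zero hdeg,
    dvd_trans (factor_dvd_of_natDegree_ne_zero hdeg) (cyclotomic.dvd_X_pow_sub_one m F),
    Irreducible.natDegree_pos (irreducible_factor _)⟩

end Summit.Ventures.DiscreteObjects.Hadamard
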